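import Mathlib.Tactic.FinCases
import Literature.Topology.FourManifolds.KirbyCalculus
import Literature.Topology.FourManifolds.PropertyRStrict
import Literature.Topology.FourManifolds.BalancedPresentation
import HarnessLib

/-!
# Barrier (SmoothPoincare4): Property 2R would trivialise the Akbulut–Kirby/Gompf presentations (Andrews–Curtis)

Barrier catalogue `Literature/Barriers/SmoothPoincare4/` (D-0021), entry for the technique class
**"prove `SmoothPoincare4` for 1-handle-free homotopy 4-spheres through the Generalised Property R
conjecture"** — route `NoOneHandles` files a link-form Generalised Property R statement as a
sufficient crux for its conjunct C2 ("geometrically simply connected homotopy 4-spheres are `S⁴`"):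
item `stmt-SmoothPoincare4-0379`, decl `NoohGprc` of `Theses/NoOneHandles.lean` (typed with
`U.IsSurgery Y` for a `0`-framed unlink `U` in place of `IsSphereTwoProdCircleSum`; it is NOT the
Literature decl `Literature.Topology.FourManifolds.GeneralizedPropertyRConjecture`). Gompf–Scharlemann–Thompson
(2010, = GST) show that Property 2R implies Andrews–Curtis triviality of the balanced presentations
`⟨x, y ∣ yxy = xyx, xⁿ⁺¹ = yⁿ⟩` of the trivial group, "deemed likely [nontrivial] by group
theorists when `n ≥ 3`", that stabilising by distant unknots does not help (it preserves the
Andrews–Curtis class), and replace the conjecture by a weaker one (cancelling Hopf pairs allowed)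
that is equivalent to the 4-manifold statement. **The catalogue entry is
`StrictPropertyTwoRBarrier`** (over the printed Property 2R,
`Literature.Topology.FourManifolds.StrictPropertyTwoRConjecture`); the two original declarations
over the tree's permissive `PropertyTwoRConjecture` are deprecated (below, "Deprecation").

## Errata (2026-08-14): permissive handle slides; the corrected barrier is `StrictPropertyTwoRBarrier`

**Statements of the original declarations are unchanged** (append-only tree); this section, the
per-declaration notes and the new declarations record a discrepancy inherited from the
prelude. By the erratum of `KirbyMoves.lean` / `KirbyCalculus.lean` (2026-08-14) the tree's
handle-slide relation `Literature.Topology.FourManifolds.IsHandleSlideEquivalent` is generated by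
the PERMISSIVE move `FramedLink.IsHandleSlide`, whose band may pass between the slid-over
component and its framing push-off; such a move is not a slide of the 2-handle and can change the
surgered 3-manifold, so `PropertyTwoRConjecture` / `GeneralizedPropertyRConjecture` are formally
WEAKER than the printed conjectures. Gompf–Scharlemann–Thompson's Andrews–Curtis invariant (§7:
"If we change `L` by sliding one component `Lᵢ` over another `Lⱼ`, then `rⱼ` ceases to be a
meridian, but it again becomes one via the dual slide … an Andrews-Curtis move") is an invariant
of GENUINE 2-handle slides only. Consequently the named fact `gst2010_propertyTwoR_andrewsCurtis`
(hypothesis: the permissive `PropertyTwoRConjecture`) and the barrier `PropertyTwoRBarrier`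
(conclusion: `¬ PropertyTwoRConjecture`) are **stronger than what the source supports** — a
permissive slide sequence from `L_{n,1}` to the unlink would not trivialise the presentation.
The corrected declaration, over the printed conjecture
`Literature.Topology.FourManifolds.StrictPropertyTwoRConjecture` (`PropertyRStrict.lean`, strict
slides `FramedLink.IsStrictHandleSlide`), is the barrier `StrictPropertyTwoRBarrier` — the one
named statement of the corrected entry (D-0021), not formalizable now (proofs sibling
`PropertyTwoRAndrewsCurtisProofs.lean`, §"Why … not discharged": an explicit smooth `L_{n,1}` with
its surgery identified, and `π₁` of surgered 3-manifolds under strict slides, are each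
theory-sized). It is Gompf–Scharlemann–Thompson's §7 implication "printed Property 2R ⇒ every
`⟨x, y ∣ yxy = xyx, xⁿ⁺¹ = yⁿ⟩` is Andrews–Curtis trivial" in contrapositive form: derived below
from that implication taken as a hypothesis (`strictPropertyTwoRBarrier_of_gst`) and EQUIVALENT to
it (`strictPropertyTwoRBarrier_iff_gst` of the proofs sibling, using GST §8 for `n ≤ 2`); the
originals imply both (`gst2010_strictPropertyTwoR_andrewsCurtis_of`,
`strictPropertyTwoRBarrier_of_propertyTwoRBarrier`). (Review of 2026-08-15, D-0026: the §7
implication had at first been vendored separately, as a named fact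
`gst2010_strictPropertyTwoR_andrewsCurtis`; being equivalent to the barrier it was a second name
for the same proof obligation and has been MERGED into `StrictPropertyTwoRBarrier` — its statement
survives verbatim as the hypothesis `hGST` of `strictPropertyTwoRBarrier_of_gst`,
`not_strictGeneralizedPropertyR_of_gst`, `not_akPresentationsACNontrivial_of_strictPropertyTwoR`
and as the conclusion of `gst2010_strictPropertyTwoR_andrewsCurtis_of`.)
Second change: scope caveat (c) of the original entry (Gompf–Scharlemann–Thompson's Andrews–Curtis
moves include changes of free basis and permutations, the tree's `IsAndrewsCurtisEquivalent` does
not) is DISCHARGED by `Literature/Topology/FourManifolds/BalancedPresentationBasisChange.lean`,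
which proves that Andrews–Curtis triviality is the same for the extended calculus with relator
permutations, elementary changes of basis and renamings
(`Literature.Topology.FourManifolds.isExtAndrewsCurtisEquivalent_trivial_iff`; conjugation by
arbitrary words is already a composite of the tree's moves, `IsAndrewsCurtisEquivalent.update_conj`
of `BalancedPresentationMoves.lean`; arbitrary automorphisms by Nielsen's theorem,
`isAndrewsCurtisEquivalent_mulAut_comp_trivial_iff` under the named fact
`autFreeGroup_eq_closure_nielsen`, since discharged — `autFreeGroup_eq_closure_nielsen_holds`,
`isAndrewsCurtisEquivalent_mulAut_comp_trivial_iff'` of `BalancedPresentationBasisChangeProofs.lean`).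
The specialisations to this barrier — the
hypothesis `AKPresentationsACNontrivial` is unchanged under the extended moves and equals the
Andrews–Curtis nontriviality of some Akbulut–Kirby presentation `akbulutKirby k`, `k ≥ 1` — are the
theorems `akPresentationsACNontrivial_iff_ext`, `isAndrewsCurtisEquivalent_gstPresentation_trivial_iff`,
`akPresentationsACNontrivial_iff_akbulutKirby` of the sibling proof file
`Literature/Barriers/SmoothPoincare4/PropertyTwoRAndrewsCurtisACMoves.lean` (in the tree).

## Deprecation (2026-08-15, named-fact verdict clean-up)

The tenured fact seats of the two ORIGINAL named statements returned the verdict **misstated —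
stronger than the source** for both `gst2010_propertyTwoR_andrewsCurtis` ("its hypothesis is the
tree's PERMISSIVE `PropertyTwoRConjecture` (collar-crossing `FramedLink.IsHandleSlide`), so the
implication is STRONGER than what Gompf–Scharlemann–Thompson prove") and `PropertyTwoRBarrier`
("stated over the PERMISSIVE `IsHandleSlideEquivalent`; GST 2010 §7 (AC invariant of genuine
2-handle slides) supports only `¬`(printed Property 2R)"). Re-read against the source on the page
(arXiv:1103.1601): §2, p. 4 — "The 4-manifold trace of the surgery on `L` is unchanged if one
2-handle is slid over another 2-handle. Such a handle slide is one of several moves allowed in the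
Kirby calculus … the effect on the link is to replace `U` by the band sum `Ū` of `U` with a
certain copy of `V`, namely the copy given by the preferred cross-section realizing the framing of
`V`"; §7, p. 17 — "Suppose `L` is an `n`-component framed link that satisfies the hypothesis of
Generalized Property R. Then surgery on `L` yields `#ₙ(S¹ × S²)`, whose fundamental group `G` is
free on `n` generators … If we change `L` by sliding one component `Lᵢ` over another `Lⱼ`, then
`rⱼ` ceases to be a meridian, but it again becomes one via the dual slide over a meridian to `Lᵢ`
… This is again an Andrews-Curtis move … Thus, the link `L` up to handle slides determines a
balanced presentation of the trivial group up to Andrews-Curtis moves." The invariant lives in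
`π₁` of the surgered manifold, which a 2-handle slide preserves and a collar-crossing band sum
need not (`KirbyMoves.lean`, Errata: the `(0, 1)`-framed split unlink, surgery `S² × S¹`, goes to
a link with surgery `S³₀(6₁)`); both verdicts stand. Actions (human ruling 2026-08-15: restate,
do not delete): both definitions are KEPT VERBATIM (terms, binders, names) and DEPRECATED towards
the corrected statement `StrictPropertyTwoRBarrier`, which already carries the faithful content
(the §7 implication over `StrictPropertyTwoRConjecture`, to which it is equivalent,
`strictPropertyTwoRBarrier_iff_gst`); the in-file theorems that consume the deprecated statements
as hypotheses (`gst2010_strictPropertyTwoR_andrewsCurtis_of`, `propertyTwoRBarrier_of_gst`,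
`not_generalizedPropertyR_of_gst`, `not_akPresentationsACNontrivial_of_propertyTwoR`,
`strictPropertyTwoRBarrier_of_propertyTwoRBarrier`) are deprecated with them towards their
strict counterparts and switch `linter.deprecated` off for themselves alone, as does the
characterisation `propertyTwoRBarrier_iff_gst` of the proofs sibling; the BARRIER block (D-0021)
is now carried by `StrictPropertyTwoRBarrier` alone, so routes and idea cards address
`Literature.Barriers.SmoothPoincare4.StrictPropertyTwoRBarrier` (the deprecated
`PropertyTwoRBarrier` is no longer a catalogue entry). At the same time the hypothesis
`AKPresentationsACNontrivial` — Andrews–Curtis nontriviality of some `AK(n)`, `n ≥ 3`, open in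
both directions (GST §7: "regarded as very unlikely", "there is presently no way to distinguish
Andrews-Curtis equivalence classes from each other"; sibling
`PropertyTwoRAndrewsCurtisHypothesis.lean`) — is registered as an OPEN CONJECTURE (CONVENTIONS §4,
docstring `OPEN CONJECTURE — … [status: open]`; name kept because of its users), not as
dischargeable debt. No statement changed; the declarations are only re-ordered (presentations,
hypothesis, corrected entry, deprecated originals).

## What is printed (Gompf–Scharlemann–Thompson 2010 = GST; arXiv pages)

* §1 (p. 2): "We conclude that the conjecture [Generalized Property R] is probably false, and
  analyze potential counterexamples. ... We also propose a weaker version of the Generalized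
  Property R Conjecture that seems much more likely, and is related to the 4-dimensional smooth
  Poincaré Conjecture."; and, the barrier itself: "We show in Section 7 that `L_{n,1}` is a
  counterexample to the Generalized Property R Conjecture provided that the presentation
  `⟨x, y ∣ yxy = xyx, xⁿ⁺¹ = yⁿ⟩` of the trivial group is Andrews-Curtis nontrivial, as is deemed
  likely by group theorists when `n ≥ 3`." §2, Conjecture 1 (Generalized Property R: "there is a
  sequence of handle slides on `L` that converts `L` into a `0`-framed unlink", the slide being
  the 2-handle slide of §2) and the tree's `Literature.Topology.FourManifolds.StrictGeneralizedPropertyRConjecture` /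
  `StrictPropertyTwoRConjecture` (printed form), `GeneralizedPropertyRConjecture` /
  `PropertyTwoRConjecture` (permissive form) (Kirby Problem 1.82).
* §7 (p. 14; arXiv p. 17): the diagram of [Go1] "exhibits a simply connected 2-complex, presenting the trivial
  group as `⟨x, y ∣ y = w⁻¹xw, xⁿ⁺¹ = yⁿ⟩`, where `w` is some word in `x^{±1}, y^{±1}` depending on
  `k` and equal to `yx` when `k = 1`. If the 2-component link `L_{n,k}` of Figure 11 ... can be
  changed to the unlink by handle slides, then the dual slides in Figure 9 will trivialize that
  picture, showing that the above presentation is Andrews-Curtis trivial. For `k = 1`, for example,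
  this is regarded as very unlikely when `n ≥ 3`. (For `n ≤ 2`, see Section 8.) Since surgery on
  `L_{n,k}` is `#²(S¹ × S²)` by construction, this suggests an affirmative answer to Question Two,
  which (for any one `n`) would imply: Conjecture 3. The square knot does not have Property 2R."
  Mechanism, same page: "the link `L` up to handle slides determines a balanced presentation of
  the trivial group up to Andrews-Curtis moves" (meridians normally generate the free group
  `π₁(#ⁿ(S¹ × S²))`, whose basis "is unique up to Nielsen moves"; a handle slide multiplies a
  relator by a conjugate of another).
* §8 (p. 15): for `n = 0, 1` or `k = 0` or `(n, k) = (2, 1)` "the corresponding presentation is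
  Andrews-Curtis trivial" (Gersten for `(2, 1)`), and then `L_{n,k}` satisfies the conclusion of
  Generalized Property R.
* §9 (pp. 16-17): Conjecture 4 (Weak Generalized Property R: allow a distant `0`-framed unlink and
  cancelling Hopf pairs) — "The move to Weak Generalized Property R destroys the Andrews-Curtis
  invariant"; Proposition 9.2: "The Weak Generalized Property R Conjecture is equivalent to the
  Smooth 4-Dimensional Poincaré Conjecture for homotopy spheres that admit handle decompositions
  without 1-handles."

## How it is rendered here (relative to the tree's notions, D-0014)

* `gstPresentation n` — the presentation `⟨x, y ∣ yxy = xyx, xⁿ⁺¹ = yⁿ⟩` (the case `k = 1`,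
  `w = yx`) as a `Literature.Topology.FourManifolds.BalancedPresentation 2` (relators `yxy(xyx)⁻¹`,
  `xⁿ⁺¹y⁻ⁿ`); after interchanging `x` and `y` this is the tree's Akbulut–Kirby family
  `Literature.Topology.FourManifolds.akbulutKirby` — and Andrews–Curtis triviality of the one is
  that of the other (proved in the sibling `PropertyTwoRAndrewsCurtisACMoves.lean`,
  `isAndrewsCurtisEquivalent_gstPresentation_trivial_iff`).
* `AKPresentationsACNontrivial` — the expectation "AC-nontrivial for some `n ≥ 3`" as a
  registered OPEN CONJECTURE (`[status: open]`; not asserted, no `_holds` expected), robust under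
  the choice of Andrews–Curtis moves and equal to the nontriviality of some Akbulut–Kirby
  presentation `akbulutKirby k`, `k ≥ 1` (sibling `PropertyTwoRAndrewsCurtisACMoves.lean`); what
  it asks is spelled out in the sibling `PropertyTwoRAndrewsCurtisHypothesis.lean`.
* `StrictPropertyTwoRBarrier` — THE barrier (catalogue entry, D-0021 block):
  `AKPresentationsACNontrivial → ¬ StrictPropertyTwoRConjecture` (named statement; derived from
  the §7 implication when that is assumed, `strictPropertyTwoRBarrier_of_gst`, and equivalent to
  it, `strictPropertyTwoRBarrier_iff_gst` of the proofs sibling), with its consequence for the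
  printed generalised conjecture (`not_strictGeneralizedPropertyR_of_gst`; from the barrier itself,
  `not_strictGeneralizedPropertyR_of_barrier` of the proofs sibling). GST's §7 implication over the
  printed Property 2R is not a separate named fact: it appears verbatim as the hypothesis `hGST` of
  `strictPropertyTwoRBarrier_of_gst` and is recovered from the barrier as
  `isAndrewsCurtisEquivalent_gstPresentation_trivial_of_barrier` (proofs sibling).
* DEPRECATED (2026-08-15, misstated — stronger than the source; kept verbatim, `@[deprecated]`
  towards `StrictPropertyTwoRBarrier`): `gst2010_propertyTwoR_andrewsCurtis` (the §7 implication
  over the PERMISSIVE `PropertyTwoRConjecture`) and `PropertyTwoRBarrier`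
  (`… → ¬ PropertyTwoRConjecture`), together with their consumers
  `gst2010_strictPropertyTwoR_andrewsCurtis_of`, `propertyTwoRBarrier_of_gst`,
  `not_generalizedPropertyR_of_gst`, `not_akPresentationsACNontrivial_of_propertyTwoR`,
  `strictPropertyTwoRBarrier_of_propertyTwoRBarrier`.

## References

[GompfScharlemannThompson2010] [Gompf1991Killing] [Kirby1997] [AkbulutKirby1985]
[MeierSchirmerZupan2016] [Gabai1987] [AndrewsCurtis1965] [Johnson1997]
-/

noncomputable section

namespace Literature.Barriers.SmoothPoincare4


/-! ### The presentations -/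

/-- **The Gompf–Scharlemann–Thompson presentations** `⟨x, y ∣ yxy = xyx, xⁿ⁺¹ = yⁿ⟩` of the
trivial group (GST 2010, §7, the case `k = 1`, `w = yx` of `⟨x, y ∣ y = w⁻¹xw, xⁿ⁺¹ = yⁿ⟩`, read
off Gompf's handle diagram [Go1] of the homotopy ball built on `L_{n,1}`), as a balanced
presentation on the generators `x = x₀`, `y = x₁` with relators `r₀ = y x y (x y x)⁻¹` and
`r₁ = xⁿ⁺¹ y⁻ⁿ`. Interchanging `x` and `y` gives the tree's Akbulut–Kirby presentations
`Literature.Topology.FourManifolds.akbulutKirby` (`xᵐ = yᵐ⁺¹, xyx = yxy`), the standard potential counterexamples to the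
Andrews–Curtis conjecture. [cite: GompfScharlemannThompson2010, §7] [cite: AkbulutKirby1985, §1] -/
def gstPresentation (n : ℕ) : Literature.Topology.FourManifolds.BalancedPresentation 2 :=
  ![FreeGroup.of 1 * FreeGroup.of 0 * FreeGroup.of 1 *
      (FreeGroup.of 0 * FreeGroup.of 1 * FreeGroup.of 0)⁻¹,
    FreeGroup.of 0 ^ (n + 1) * (FreeGroup.of 1 ^ n)⁻¹]

/-- The first relator of `gstPresentation n` is `y x y (x y x)⁻¹`. [cite: GompfScharlemannThompson2010, §7] -/
@[simp] theorem gstPresentation_zero (n : ℕ) :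
    gstPresentation n 0 = FreeGroup.of 1 * FreeGroup.of 0 * FreeGroup.of 1 *
      (FreeGroup.of 0 * FreeGroup.of 1 * FreeGroup.of 0)⁻¹ := rfl

/-- The second relator of `gstPresentation n` is `xⁿ⁺¹ y⁻ⁿ`. [cite: GompfScharlemannThompson2010, §7] -/
@[simp] theorem gstPresentation_one (n : ℕ) :
    gstPresentation n 1 = FreeGroup.of 0 ^ (n + 1) * (FreeGroup.of 1 ^ n)⁻¹ := rfl

/-- **Relation to the tree's Akbulut–Kirby presentations**: for `n = k + 2`, `gstPresentation n`
is `Literature.Topology.FourManifolds.akbulutKirby k` with the generators `x`, `y` interchanged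
(`FreeGroup.map (swap 0 1)`),
the two relators listed in the opposite order, and the power relator inverted — all of which are
immaterial for Andrews–Curtis questions. [cite: AkbulutKirby1985, §1] -/
theorem gstPresentation_eq_swap_akbulutKirby (k : ℕ) :
    gstPresentation (k + 2) =
      ![FreeGroup.map (Equiv.swap (0 : Fin 2) 1) (Literature.Topology.FourManifolds.akbulutKirby k 1),
        (FreeGroup.map (Equiv.swap (0 : Fin 2) 1) (Literature.Topology.FourManifolds.akbulutKirby k 0))⁻¹] := by
  ext i
  fin_cases i <;> simp [gstPresentation, Literature.Topology.FourManifolds.akbulutKirby, map_mul, map_pow, map_inv, mul_assoc]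

/-! ### The hypothesis: Andrews–Curtis nontriviality of the presentations (OPEN CONJECTURE) -/

/-- OPEN CONJECTURE — **Andrews–Curtis nontriviality of some `⟨x, y ∣ yxy = xyx, xⁿ⁺¹ = yⁿ⟩`,
`n ≥ 3`** (the hypothesis of the barrier; not asserted): for some `n ≥ 3` the presentation
`gstPresentation n` is NOT Andrews–Curtis equivalent
(`Literature.Topology.FourManifolds.IsAndrewsCurtisEquivalent`: moves `rᵢ ↦ rᵢ⁻¹`, `rᵢ ↦ rᵢrⱼ`,
`rᵢ ↦ g rᵢ g⁻¹`) to the trivial presentation `(x, y)`. POSED — as an expectation, not a theorem —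
by Gompf–Scharlemann–Thompson, *Fibered knots and potential counterexamples to the Property 2R and
Slice-Ribbon Conjectures*, Geom. Topol. 14 (2010), §7 (arXiv p. 17): "If the 2-component link
`L_{n,k}` … can be changed to the unlink by handle slides, then the dual slides in Figure 9 will
trivialize that picture, showing that the above presentation is Andrews-Curtis trivial. For
`k = 1`, for example, this is regarded as very unlikely when `n ≥ 3`. (For `n ≤ 2`, see Section
8.)", §1 (p. 2): "Andrews-Curtis nontrivial, as is deemed likely by group theorists when `n ≥ 3`"
[cite: GompfScharlemannThompson2010, §7 (posed as an expectation); §1 p. 2; §8 (n ≤ 2 trivial)];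
up to `x ↔ y` these are the Akbulut–Kirby presentations `AK(n) = ⟨x, y ∣ xⁿ = yⁿ⁺¹, xyx = yxy⟩`,
the standard potential counterexamples to the Andrews–Curtis conjecture
[cite: AkbulutKirby1985, §1] [status: open] — neither a proof (which would exhibit an
Andrews–Curtis nontrivial balanced presentation of the trivial group, i.e. DISPROVE the unstable
Andrews–Curtis conjecture on its standard test family) nor a disproof (the Andrews–Curtis
conjecture restricted to the family, `not_akPresentationsACNontrivial_iff` of the sibling
`PropertyTwoRAndrewsCurtisHypothesis.lean`) is in print; GST, §7: "Unfortunately, there is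
presently no way to distinguish Andrews-Curtis equivalence classes from each other." For `n ≤ 2`
the presentations ARE Andrews–Curtis trivial (GST §8, Gersten for `n = 2`;
`isAndrewsCurtisEquivalent_gstPresentation_trivial_of_le_two` of the proofs sibling
`PropertyTwoRAndrewsCurtisProofs.lean`, so the guard `3 ≤ n` is automatic,
`akPresentationsACNontrivial_iff_exists`). Registered here as an OPEN statement (CONVENTIONS §4:
an open conjecture is a `def … : Prop`, never asserted), not as named-fact debt: no
`AKPresentationsACNontrivial_holds` is to be expected, and users keep the explicit hypothesis
`(hAC : AKPresentationsACNontrivial)` — it is the antecedent of the barrier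
`StrictPropertyTwoRBarrier` (and of the deprecated `PropertyTwoRBarrier`). The name is kept (not
renamed `…Conjecture`) because of its in-tree users (the three sibling proof files). The choice of
Andrews–Curtis moves is immaterial and the statement is the nontriviality of some Akbulut–Kirby
presentation `akbulutKirby k` (`akPresentationsACNontrivial_iff_ext`,
`akPresentationsACNontrivial_iff_akbulutKirby` of `PropertyTwoRAndrewsCurtisACMoves.lean`,
`akPresentationsACNontrivial_iff_exists_akbulutKirby` of `PropertyTwoRAndrewsCurtisHypothesis.lean`);
every `gstPresentation n` presents the trivial group (`presentsTrivialGroup_gstPresentation`,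
same sibling), so each instance is a genuine instance of the Andrews–Curtis problem. Statement
unchanged (2026-08-15: docstring marked `OPEN CONJECTURE — … [status: open]`). -/
def AKPresentationsACNontrivial : Prop :=
  ∃ n : ℕ, 3 ≤ n ∧ ¬ Literature.Topology.FourManifolds.IsAndrewsCurtisEquivalent (gstPresentation n) (Literature.Topology.FourManifolds.BalancedPresentation.trivial 2)

/-! ### The barrier over the printed Property 2R (the catalogue entry; conditional on Andrews–Curtis nontriviality, which is open) -/

variable [Literature.Topology.FourManifolds.SphereEmbedding.SmoothnessFacts] [Literature.Topology.FourManifolds.Knot.TubularNbhd.SmoothnessFacts]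

/-- **Barrier (named statement, conditional form): if some `⟨x, y ∣ yxy = xyx, xⁿ⁺¹ = yⁿ⟩`,
`n ≥ 3`, is Andrews–Curtis nontrivial, then the PRINTED Property 2R
(`Literature.Topology.FourManifolds.StrictPropertyTwoRConjecture`, genuine 2-handle slides) is
false** — hence so is the printed Generalised Property R conjecture
(`not_strictGeneralizedPropertyR_of_gst`; `not_strictGeneralizedPropertyR_of_barrier` of the
proofs sibling). This is the ONE named statement of the entry (D-0021; not formalizable
now — proofs sibling `PropertyTwoRAndrewsCurtisProofs.lean`, §"Why … not discharged"). It is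
Gompf–Scharlemann–Thompson's printed §7 implication in contrapositive form — "If the 2-component
link `L_{n,k}` … can be changed to the unlink by handle slides, then the dual slides in Figure 9
will trivialize that picture, showing that the above presentation
[`⟨x, y ∣ y = w⁻¹xw, xⁿ⁺¹ = yⁿ⟩`, `w = yx` for `k = 1`] is Andrews-Curtis trivial", surgery on
`L_{n,k}` being `#₂(S¹ × S²)` "by construction", i.e.
`StrictPropertyTwoRConjecture → ∀ n, IsAndrewsCurtisEquivalent (gstPresentation n) (trivial 2)`:
derived below from that implication taken as the hypothesis `hGST`
(`strictPropertyTwoRBarrier_of_gst`) and EQUIVALENT to it (`strictPropertyTwoRBarrier_iff_gst` of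
the proofs sibling, the presentations with `n ≤ 2` being Andrews–Curtis trivial outright, GST §8).
The GLOBAL printed Property 2R in place of GST's per-knot statement ("the square knot has Property
2R", whose negation is their Conjecture 3) makes the implication weaker, hence this barrier's
conclusion `¬ StrictPropertyTwoRConjecture` weaker, than what is printed; the tree has no per-knot
Property `n`R predicate. (Review of 2026-08-15, D-0026: the implication, at first vendored
separately as a named fact `gst2010_strictPropertyTwoR_andrewsCurtis`, was a second name for this
proof obligation and has been merged into this statement.) It is implied by the original
`PropertyTwoRBarrier` over the tree's permissive `PropertyTwoRConjecture`
(`strictPropertyTwoRBarrier_of_propertyTwoRBarrier`), which over-states the source and is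
DEPRECATED towards this statement (2026-08-15, "Deprecation" in the module docstring); this is
the catalogue entry routes address.

BARRIER (D-0021), one line per key:
* technique_class: proving `SmoothPoincare4` (for homotopy 4-spheres with 1-handle-free handle decompositions) via the Generalised Property R conjecture in its printed form `Literature.Topology.FourManifolds.StrictGeneralizedPropertyRConjecture` — 2-handle slides alone turn any framed link with surgery `#ⁿ(S² × S¹)` into the `0`-framed unlink [cite: GompfScharlemannThompson2010, §2 Conjecture 1] [cite: Kirby1997, Problem 1.82]; already its case `n = 2`, `Literature.Topology.FourManifolds.StrictPropertyTwoRConjecture`.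
* blocks: the printed Property 2R `Literature.Topology.FourManifolds.StrictPropertyTwoRConjecture` and with it `Literature.Topology.FourManifolds.StrictGeneralizedPropertyRConjecture` (`not_strictGeneralizedPropertyR_of_gst`), CONDITIONALLY on `AKPresentationsACNontrivial`: the printed Property 2R forces Andrews–Curtis triviality of `⟨x, y ∣ yxy = xyx, xⁿ⁺¹ = yⁿ⟩` for all `n` (GST §7; the hypothesis `hGST` of `strictPropertyTwoRBarrier_of_gst`, equivalent to this statement by `strictPropertyTwoRBarrier_iff_gst`), "deemed likely [nontrivial] by group theorists when `n ≥ 3`"; "We conclude that the conjecture is probably false" [cite: GompfScharlemannThompson2010, §1 p. 2 and §7]; any route statement that IMPLIES the printed conjecture (a strict-slide form of `NoohGprc`, item `stmt-SmoothPoincare4-0379`) falls with it; ALSO blocked, conditionally on STABLE Andrews–Curtis nontriviality (tree `Literature.Topology.FourManifolds.IsStablyAndrewsCurtisEquivalent`): the unlink-only stabilised version (first add a distant `0`-framed unlink, then slide), because "stabilization by adding a distant unknot ... preserves the Andrews-Curtis class" [cite: GompfScharlemannThompson2010, §9 p. 16] (formal version deferred until a `FramedLink` stabilisation API exists).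
* because: a framed `n`-component link `L` with surgery `#ⁿ(S¹ × S²)` determines a balanced presentation of the trivial group — meridians as relators in the free group `π₁(#ⁿ(S¹ × S²))`, basis "unique up to Nielsen moves" — well defined up to Andrews–Curtis moves, and a 2-handle slide of `Lᵢ` over `Lⱼ` multiplies `rⱼ` by a conjugate of `rᵢ` (dual slide), again an Andrews–Curtis move; the `0`-framed unlink gives the trivial presentation; for `L_{n,1}` (square knot interleaved with `T_{n,n+1} # mirror`) the presentation is `⟨x, y ∣ yxy = xyx, xⁿ⁺¹ = yⁿ⟩`, read off Gompf's diagram [cite: GompfScharlemannThompson2010, §7] [cite: Gompf1991Killing, handle diagram (GST's [Go1])]; Andrews–Curtis TRIVIALITY does not depend on whether conjugation by words, relator permutations and elementary changes of free basis are allowed (proved, `Literature/Topology/FourManifolds/BalancedPresentationBasisChange.lean` and the sibling `PropertyTwoRAndrewsCurtisACMoves.lean`; arbitrary automorphisms given Nielsen's theorem [cite: Johnson1997, Ch. 3 §4 Cor. 7]).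
* evasions_known: (i) the Weak Generalized Property R conjecture WITH cancelling 1/2-handle Hopf pairs (`s ≥ 1`; "the Hopf pairs seem crucial"), which "destroys the Andrews-Curtis invariant", is satisfied by all `L_{n,k}` (already with `r = 0`, `s = 1`), and is EQUIVALENT to `SmoothPoincare4` for homotopy 4-spheres admitting handle decompositions without 1-handles [cite: GompfScharlemannThompson2010, §9 Conjecture 4, p. 16 and Prop. 9.2]; (ii) `n = 1` is Gabai's Property R, unconditionally [cite: Gabai1987, Cor. 8.3]; (iii) trisection reformulation and the stable version of Generalized Property R [cite: MeierSchirmerZupan2016, Thm. 1.1 and §1].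
* scope_caveats: (a) CONDITIONAL: Andrews–Curtis nontriviality of these presentations (`AKPresentationsACNontrivial`, a registered open conjecture; equivalently of some Akbulut–Kirby presentation `akbulutKirby k`, `k ≥ 1`, sibling `PropertyTwoRAndrewsCurtisACMoves.lean`) is open — GST print an expectation ("regarded as very unlikely"), not a theorem [cite: GompfScharlemannThompson2010, §7]; (b) the implication is printed as prose in §7 resting on the diagrams of Figures 9 and 11 and on [Go1], not as a numbered theorem, and is rendered (contrapositively) by this named statement over the GLOBAL printed Property 2R where the per-knot statement for the square knot would suffice [cite: GompfScharlemannThompson2010, §7 and Conjecture 3]; (c) the PERMISSIVE tree statements `Literature.Topology.FourManifolds.PropertyTwoRConjecture` / `GeneralizedPropertyRConjecture` and the route decl `NoohGprc` (all over `IsHandleSlideEquivalent`, whose generating "slide" can change the surgered manifold — `KirbyMoves.lean` Errata) are NOT reached by the Andrews–Curtis invariant: the original `PropertyTwoRBarrier` over-states the source (deprecated 2026-08-15), and nothing printed obstructs a permissive slide sequence [cite: GompfScharlemannThompson2010, §7]; (d) only `k = 1` (`w = yx`) is rendered; (e) nothing here bears on conjunct C2 of route `NoOneHandles` itself, which by Prop.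 9.2 is equivalent to the WEAK conjecture, untouched by the Andrews–Curtis invariant [cite: GompfScharlemannThompson2010, Prop. 9.2].
* status: established in print as a conditional implication (GST §7, prose resting on Figures 9, 11 and [Go1]); here a named statement (D-0021), derived from the §7 implication when that is assumed (`strictPropertyTwoRBarrier_of_gst`) and equivalent to it (`strictPropertyTwoRBarrier_iff_gst`); the unconditional failure of the printed Property 2R is conjectural [cite: GompfScharlemannThompson2010, §1, §7, Conjecture 3]

[cite: GompfScharlemannThompson2010, §1 p. 2 and §7] -/
def StrictPropertyTwoRBarrier : Prop :=
  AKPresentationsACNontrivial → ¬ Literature.Topology.FourManifolds.StrictPropertyTwoRConjecture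

/-- **`StrictPropertyTwoRBarrier` follows from GST's faithful §7 implication** "printed Property 2R
⇒ every `⟨x, y ∣ yxy = xyx, xⁿ⁺¹ = yⁿ⟩` is Andrews–Curtis trivial", taken as the hypothesis `hGST`
(D-0014): an Andrews–Curtis nontrivial `gstPresentation n` contradicts the triviality that the
printed Property 2R would force. The converse is `strictPropertyTwoRBarrier_iff_gst` (proofs
sibling). [cite: GompfScharlemannThompson2010, §7] -/
theorem strictPropertyTwoRBarrier_of_gst
    (hGST : Literature.Topology.FourManifolds.StrictPropertyTwoRConjecture →
      ∀ n : ℕ, Literature.Topology.FourManifolds.IsAndrewsCurtisEquivalent (gstPresentation n)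
        (Literature.Topology.FourManifolds.BalancedPresentation.trivial 2)) :
    StrictPropertyTwoRBarrier := by
  rintro ⟨n, -, hn⟩ h2R
  exact hn (hGST h2R n)

/-- **Consequently the printed Generalised Property R conjecture fails too** (it contains the
printed Property 2R as the case `n = 2`,
`Literature.Topology.FourManifolds.strictPropertyTwoRConjecture_of_strictGeneralized`), GIVEN the
faithful GST implication and Andrews–Curtis nontriviality of some `gstPresentation n`, `n ≥ 3` —
GST: "We conclude that the conjecture is probably false".
[cite: GompfScharlemannThompson2010, §1 ("probably false") and §7] -/
theorem not_strictGeneralizedPropertyR_of_gst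
    (hGST : Literature.Topology.FourManifolds.StrictPropertyTwoRConjecture →
      ∀ n : ℕ, Literature.Topology.FourManifolds.IsAndrewsCurtisEquivalent (gstPresentation n)
        (Literature.Topology.FourManifolds.BalancedPresentation.trivial 2))
    (hAC : AKPresentationsACNontrivial) :
    ¬ Literature.Topology.FourManifolds.StrictGeneralizedPropertyRConjecture :=
  fun h ↦ strictPropertyTwoRBarrier_of_gst hGST hAC
    (Literature.Topology.FourManifolds.strictPropertyTwoRConjecture_of_strictGeneralized h)

/-- Contrapositive reading of the barrier: GIVEN the faithful GST implication, a proof of the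
printed Property 2R proves that every `⟨x, y ∣ yxy = xyx, xⁿ⁺¹ = yⁿ⟩` (`n ≥ 3` included) is
Andrews–Curtis trivial, i.e. it settles these standard potential counterexamples to the
Andrews–Curtis conjecture positively (from the barrier itself instead of `hGST`: it is literally
`fun hAC ↦ hB hAC h2R`). [cite: GompfScharlemannThompson2010, §7] -/
theorem not_akPresentationsACNontrivial_of_strictPropertyTwoR
    (hGST : Literature.Topology.FourManifolds.StrictPropertyTwoRConjecture →
      ∀ n : ℕ, Literature.Topology.FourManifolds.IsAndrewsCurtisEquivalent (gstPresentation n)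
        (Literature.Topology.FourManifolds.BalancedPresentation.trivial 2))
    (h2R : Literature.Topology.FourManifolds.StrictPropertyTwoRConjecture) : ¬ AKPresentationsACNontrivial :=
  fun hAC ↦ strictPropertyTwoRBarrier_of_gst hGST hAC h2R

/-! ### Deprecated original declarations over the permissive Property 2R (verdict clean-up 2026-08-15)

Kept verbatim (terms, binders, names; append-only tree) and deprecated as named facts towards the
corrected statement `StrictPropertyTwoRBarrier`; each consumer below must name a deprecated
statement and switches `linter.deprecated` off for itself alone. -/

/-- **DEPRECATED as a named fact — MISSTATED, stronger than the source (verdict clean-up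
2026-08-15); the corrected statement is carried by `StrictPropertyTwoRBarrier`.** The original
rendering of Gompf–Scharlemann–Thompson 2010, §7: if Property 2R holds — here the tree's
PERMISSIVE `Literature.Topology.FourManifolds.PropertyTwoRConjecture` (every 2-component framed
link in `S³` whose surgery is `(S² × S¹) # (S² × S¹)` is `IsHandleSlideEquivalent` to the
`0`-framed unlink) — then for every `n` the presentation `⟨x, y ∣ yxy = xyx, xⁿ⁺¹ = yⁿ⟩` is
Andrews–Curtis trivial (`Literature.Topology.FourManifolds.IsAndrewsCurtisEquivalent`, moves
`rᵢ ↦ rᵢ⁻¹`, `rᵢ ↦ rᵢrⱼ`, `rᵢ ↦ g rᵢ g⁻¹`, to the trivial presentation `(x, y)`): the link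
`L_{n,1}` has surgery `#²(S¹ × S²)` "by construction", and "If the 2-component link `L_{n,k}` ...
can be changed to the unlink by handle slides, then the dual slides in Figure 9 will trivialize
that picture, showing that the above presentation is Andrews-Curtis trivial".

What was wrong: GST's handle slides are 2-handle slides — "The 4-manifold trace of the surgery on
`L` is unchanged if one 2-handle is slid over another 2-handle … the effect on the link is to
replace `U` by the band sum `Ū` of `U` with a certain copy of `V`, namely the copy given by the
preferred cross-section realizing the framing of `V`" (§2, arXiv p. 4) — and their Andrews–Curtis
invariant lives in `π₁` of the surgered manifold, which such a slide leaves unchanged (§7, arXiv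
p. 17: "If we change `L` by sliding one component `Lᵢ` over another `Lⱼ`, then `rⱼ` ceases to be
a meridian, but it again becomes one via the dual slide … This is again an Andrews-Curtis move").
The tree's `IsHandleSlideEquivalent` is generated by the PERMISSIVE `FramedLink.IsHandleSlide`,
whose band may cross the collar between the slid-over component and its framing push-off; such a
move is in general not a 2-handle slide and can change the surgered 3-manifold (`KirbyMoves.lean`,
Errata: the `(0, 1)`-framed split unlink, surgery `S² × S¹`, goes to a link with surgery
`S³₀(6₁)`), so nothing printed makes it act by Andrews–Curtis moves. Hence the hypothesis
`PropertyTwoRConjecture` is WEAKER than the printed Property 2R and this implication is STRONGER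
than what §7 proves: no `_holds` can be transcribed from the source (tenured fact-seat verdict
2026-08-15: misstated; re-read against §2 and §7 on the page, the verdict stands). The faithful
implication is the same statement over the printed
`Literature.Topology.FourManifolds.StrictPropertyTwoRConjecture` (strict slides,
`FramedLink.IsStrictHandleSlide`), `StrictPropertyTwoRConjecture → ∀ n, IsAndrewsCurtisEquivalent
(gstPresentation n) (trivial 2)`; under the fact discipline (D-0026, review of 2026-08-15) it is
not a separate named fact but is EQUIVALENT to the corrected barrier `StrictPropertyTwoRBarrier`
(`strictPropertyTwoRBarrier_iff_gst`, proofs sibling — the cases `n ≤ 2` being Andrews–Curtis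
trivial outright, GST §8), appears verbatim as the hypothesis `hGST` of
`strictPropertyTwoRBarrier_of_gst`, `not_strictGeneralizedPropertyR_of_gst`,
`not_akPresentationsACNontrivial_of_strictPropertyTwoR`, and is recovered from the barrier as
`isAndrewsCurtisEquivalent_gstPresentation_trivial_of_barrier` (proofs sibling). This definition
is therefore deprecated towards `StrictPropertyTwoRBarrier`; it still implies the faithful
implication (`gst2010_strictPropertyTwoR_andrewsCurtis_of`, since the printed Property 2R implies
the permissive one, `Literature.Topology.FourManifolds.propertyTwoRConjecture_of_strict`). Never
discharge it (`_holds`) or take `(h : gst2010_propertyTwoR_andrewsCurtis)` as a hypothesis; its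
consumers `gst2010_strictPropertyTwoR_andrewsCurtis_of`, `propertyTwoRBarrier_of_gst`,
`not_generalizedPropertyR_of_gst`, `not_akPresentationsACNontrivial_of_propertyTwoR` and the
characterisation `propertyTwoRBarrier_iff_gst` (proofs sibling) are deprecated with it.
[cite: GompfScharlemannThompson2010, §1 p. 2 and §7 (printed for 2-handle slides, i.e. over StrictPropertyTwoRConjecture; this permissive-hypothesis rendering over-states it — corrected: StrictPropertyTwoRBarrier)] -/
@[deprecated StrictPropertyTwoRBarrier "MISSTATED (stronger than the source): the hypothesis is the tree's PERMISSIVE PropertyTwoRConjecture (collar-crossing `FramedLink.IsHandleSlide`, KirbyMoves.lean Errata), whereas Gompf–Scharlemann–Thompson 2010, §2/§7 establish the Andrews–Curtis invariant for genuine 2-handle slides only; the faithful implication `StrictPropertyTwoRConjecture → ∀ n, IsAndrewsCurtisEquivalent (gstPresentation n) (BalancedPresentation.trivial 2)` is carried by (and equivalent to, strictPropertyTwoRBarrier_iff_gst) the corrected barrier Literature.Barriers.SmoothPoincare4.StrictPropertyTwoRBarrier — as a hypothesis use `hGST` of strictPropertyTwoRBarrier_of_gst, or `(hB : StrictPropertyTwoRBarrier)`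 with isAndrewsCurtisEquivalent_gstPresentation_trivial_of_barrier (PropertyTwoRAndrewsCurtisProofs.lean)" (since := "2026-08-15")]
def gst2010_propertyTwoR_andrewsCurtis : Prop :=
  Literature.Topology.FourManifolds.PropertyTwoRConjecture →
    ∀ n : ℕ, Literature.Topology.FourManifolds.IsAndrewsCurtisEquivalent (gstPresentation n) (Literature.Topology.FourManifolds.BalancedPresentation.trivial 2)

-- `linter.deprecated` is switched off for the next declaration only: its hypothesis IS the
-- deprecated (misstated) named fact `gst2010_propertyTwoR_andrewsCurtis`, and it is deprecated with it.
set_option linter.deprecated false in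
/-- **DEPRECATED with its hypothesis (2026-08-15).** The original (permissive-hypothesis) named
fact implies GST's faithful §7 implication over the printed Property 2R —
`StrictPropertyTwoRConjecture → ∀ n, ⟨x, y ∣ yxy = xyx, xⁿ⁺¹ = yⁿ⟩` Andrews–Curtis trivial — since
the printed Property 2R implies the permissive `PropertyTwoRConjecture`
(`Literature.Topology.FourManifolds.propertyTwoRConjecture_of_strict`). Its hypothesis can never be
supplied from the source (deprecated, misstated); the faithful implication is the hypothesis
`hGST` of `strictPropertyTwoRBarrier_of_gst` and, under the corrected barrier,
`isAndrewsCurtisEquivalent_gstPresentation_trivial_of_barrier` (proofs sibling). [folklore] -/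
@[deprecated "its hypothesis gst2010_propertyTwoR_andrewsCurtis is deprecated (misstated, 2026-08-15): the faithful §7 implication is the hypothesis `hGST` of strictPropertyTwoRBarrier_of_gst, recovered from the corrected barrier by isAndrewsCurtisEquivalent_gstPresentation_trivial_of_barrier (PropertyTwoRAndrewsCurtisProofs.lean)" (since := "2026-08-15")]
theorem gst2010_strictPropertyTwoR_andrewsCurtis_of (h : gst2010_propertyTwoR_andrewsCurtis) :
    Literature.Topology.FourManifolds.StrictPropertyTwoRConjecture →
      ∀ n : ℕ, Literature.Topology.FourManifolds.IsAndrewsCurtisEquivalent (gstPresentation n)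
        (Literature.Topology.FourManifolds.BalancedPresentation.trivial 2) :=
  fun h2R ↦ h (Literature.Topology.FourManifolds.propertyTwoRConjecture_of_strict h2R)

/-- **DEPRECATED as a named fact — MISSTATED, stronger than the source (verdict clean-up
2026-08-15); the corrected statement is `StrictPropertyTwoRBarrier`.** The original barrier
statement (conditional form): if some `⟨x, y ∣ yxy = xyx, xⁿ⁺¹ = yⁿ⟩`, `n ≥ 3`, is Andrews–Curtis
nontrivial (`AKPresentationsACNontrivial`), then Property 2R — here the tree's PERMISSIVE
`Literature.Topology.FourManifolds.PropertyTwoRConjecture` — is false; proved below from the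
equally deprecated named fact (`propertyTwoRBarrier_of_gst`) and equivalent to it
(`propertyTwoRBarrier_iff_gst`, proofs sibling).

What was wrong: `PropertyTwoRConjecture` concludes with the PERMISSIVE `IsHandleSlideEquivalent`
(band allowed between the slid-over component and its push-off — not a 2-handle slide, and able
to change the surgered 3-manifold: `KirbyMoves.lean`, Errata), which makes it WEAKER than the
printed Property 2R, so its negation — the conclusion here — is STRONGER than the negation of the
printed conjecture. Gompf–Scharlemann–Thompson's §7 argument ("the link `L` up to handle slides
determines a balanced presentation of the trivial group up to Andrews-Curtis moves", for the
2-handle slides of §2, arXiv pp. 4 and 17) supports only: Andrews–Curtis nontriviality of some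
`gstPresentation n` refutes the PRINTED Property 2R,
`Literature.Topology.FourManifolds.StrictPropertyTwoRConjecture`; a permissive slide sequence from
`L_{n,1}` to the unlink would not trivialise the presentation, and nothing printed excludes one.
Hence no `PropertyTwoRBarrier_holds` can be transcribed from the source (tenured fact-seat
verdict 2026-08-15: misstated; re-read against §2 and §7 on the page, the verdict stands). The
corrected statement, `AKPresentationsACNontrivial → ¬ StrictPropertyTwoRConjecture`, is the
barrier `StrictPropertyTwoRBarrier` above — THE catalogue entry (its BARRIER block supersedes the
one this declaration used to carry; routes address
`Literature.Barriers.SmoothPoincare4.StrictPropertyTwoRBarrier`) — towards which this definition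
is deprecated; this statement still implies it (`strictPropertyTwoRBarrier_of_propertyTwoRBarrier`).
Body, binders and name are unchanged (append-only tree). Never discharge it or take
`(h : PropertyTwoRBarrier)` as a hypothesis; its consumers `not_generalizedPropertyR_of_gst`,
`not_akPresentationsACNontrivial_of_propertyTwoR`, `strictPropertyTwoRBarrier_of_propertyTwoRBarrier`
and `propertyTwoRBarrier_iff_gst` (proofs sibling) are deprecated with it.
[cite: GompfScharlemannThompson2010, §1 p. 2 and §7 (printed for 2-handle slides: supports ¬ StrictPropertyTwoRConjecture only; this rendering over the permissive PropertyTwoRConjecture over-states it — corrected: StrictPropertyTwoRBarrier)] -/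
@[deprecated StrictPropertyTwoRBarrier "MISSTATED (stronger than the source): the conclusion ¬ PropertyTwoRConjecture negates the tree's PERMISSIVE Property 2R (collar-crossing `FramedLink.IsHandleSlide`, KirbyMoves.lean Errata), whereas Gompf–Scharlemann–Thompson 2010, §2/§7 (Andrews–Curtis invariant of genuine 2-handle slides) support only ¬ StrictPropertyTwoRConjecture — corrected statement: Literature.Barriers.SmoothPoincare4.StrictPropertyTwoRBarrier (the catalogue entry; derived from the §7 implication by strictPropertyTwoRBarrier_of_gst, equivalent to it by strictPropertyTwoRBarrier_iff_gst)" (since := "2026-08-15")]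
def PropertyTwoRBarrier : Prop :=
  AKPresentationsACNontrivial → ¬ Literature.Topology.FourManifolds.PropertyTwoRConjecture

-- `linter.deprecated` is switched off for the next declaration only: it derives the deprecated
-- `PropertyTwoRBarrier` from the deprecated `gst2010_propertyTwoR_andrewsCurtis` and must name both.
set_option linter.deprecated false in
/-- **DEPRECATED with its statement (2026-08-15).** `PropertyTwoRBarrier` follows from the
original GST named fact (hypothesis `hGST`, D-0014): an Andrews–Curtis nontrivial
`gstPresentation n` contradicts the triviality that (permissive) Property 2R would force. Both
names are deprecated (misstated); the corrected derivation is `strictPropertyTwoRBarrier_of_gst`.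
[cite: GompfScharlemannThompson2010, §7] -/
@[deprecated strictPropertyTwoRBarrier_of_gst (since := "2026-08-15")]
theorem propertyTwoRBarrier_of_gst (hGST : gst2010_propertyTwoR_andrewsCurtis) :
    PropertyTwoRBarrier := by
  rintro ⟨n, -, hn⟩ h2R
  exact hn (hGST h2R n)

-- `linter.deprecated` is switched off for the next declaration only: its hypothesis is the
-- deprecated `gst2010_propertyTwoR_andrewsCurtis` and its proof names `propertyTwoRBarrier_of_gst`.
set_option linter.deprecated false in
/-- **DEPRECATED with its hypothesis (2026-08-15).** Consequently the (permissive) Generalised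
Property R conjecture fails too (it contains Property 2R as the case `n = 2`, tree
`Literature.Topology.FourManifolds.propertyTwoRConjecture_of_generalizedPropertyRConjecture`),
GIVEN the original GST named fact and Andrews–Curtis nontriviality of some `gstPresentation n`,
`n ≥ 3`. The hypothesis `hGST` is deprecated (misstated); the corrected statement, over the
printed conjecture, is `not_strictGeneralizedPropertyR_of_gst`.
[cite: GompfScharlemannThompson2010, §1 ("probably false") and §7] -/
@[deprecated not_strictGeneralizedPropertyR_of_gst (since := "2026-08-15")]
theorem not_generalizedPropertyR_of_gst (hGST : gst2010_propertyTwoR_andrewsCurtis)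
    (hAC : AKPresentationsACNontrivial) : ¬ Literature.Topology.FourManifolds.GeneralizedPropertyRConjecture :=
  fun h => propertyTwoRBarrier_of_gst hGST hAC
    (Literature.Topology.FourManifolds.propertyTwoRConjecture_of_generalizedPropertyRConjecture h)

-- `linter.deprecated` is switched off for the next declaration only: its hypothesis is the
-- deprecated `gst2010_propertyTwoR_andrewsCurtis` and its proof names `propertyTwoRBarrier_of_gst`.
set_option linter.deprecated false in
/-- **DEPRECATED with its hypothesis (2026-08-15).** Contrapositive reading of the original
barrier: GIVEN the original GST named fact, a proof of (permissive) Property 2R would prove that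
every `⟨x, y ∣ yxy = xyx, xⁿ⁺¹ = yⁿ⟩` (`n ≥ 3` included) is Andrews–Curtis trivial. The hypothesis
`hGST` is deprecated (misstated); the corrected statement is
`not_akPresentationsACNontrivial_of_strictPropertyTwoR`. [cite: GompfScharlemannThompson2010, §7] -/
@[deprecated not_akPresentationsACNontrivial_of_strictPropertyTwoR (since := "2026-08-15")]
theorem not_akPresentationsACNontrivial_of_propertyTwoR (hGST : gst2010_propertyTwoR_andrewsCurtis)
    (h2R : Literature.Topology.FourManifolds.PropertyTwoRConjecture) : ¬ AKPresentationsACNontrivial :=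
  fun hAC => propertyTwoRBarrier_of_gst hGST hAC h2R

-- `linter.deprecated` is switched off for the next declaration only: its hypothesis IS the
-- deprecated `PropertyTwoRBarrier`, which it relates to the corrected barrier.
set_option linter.deprecated false in
/-- **DEPRECATED with its hypothesis (2026-08-15).** The original barrier implies the corrected
one (the printed Property 2R implies the permissive tree statement,
`Literature.Topology.FourManifolds.propertyTwoRConjecture_of_strict`); the converse is not
available — the original over-states the source and is deprecated: name
`StrictPropertyTwoRBarrier` directly. [folklore] -/
@[deprecated "its hypothesis PropertyTwoRBarrier is deprecated (misstated, 2026-08-15): name the corrected barrier Literature.Barriers.SmoothPoincare4.StrictPropertyTwoRBarrier directly (derived from the §7 implication by strictPropertyTwoRBarrier_of_gst)" (since := "2026-08-15")]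
theorem strictPropertyTwoRBarrier_of_propertyTwoRBarrier (h : PropertyTwoRBarrier) :
    StrictPropertyTwoRBarrier :=
  fun hAC h2R ↦ h hAC (Literature.Topology.FourManifolds.propertyTwoRConjecture_of_strict h2R)

end Literature.Barriers.SmoothPoincare4

end
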